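import Summits.QuantumFields.BalabanUV.T4Continuum.Support.NE7PairwiseOffsetEndWindow

/-!
# NE7PairwiseDeepBadClass — row NE7 (node U5), route «PAIR-CAUCHY» (R-P2, 1-bis): the SHAPE of the K-only bad-class weight —
# a union over LEVELS of ONE run (never over runs), bounded by the TAIL of a per-level suppression sequence that is summable
# IN THE LEVEL INDEX; hence `W w K ≤ η w` UNIFORMLY IN `K` with `η w → 0` — the binders `hWη`, `hη` of
# `NE7PairwiseOffsetEndWindow.pairCauchy_of_kOnlyBadClasses`, with no summability in the run index anywhere

Cell `pub-balaban`, rung (B)+1 sub-cell t4, lineage `b2b-balaban-t4-ne7-p2` (CRUX PROVER NE7 #2 under the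
coordinator ruling «YM redirect», 2026-08-21; generation 54; texts: `HOME/t4/b2b-balaban-t4-ne7-p2/g54/ROUTE2-NE7-P2.md`
v1.9 §2 NODE W♭ («for every FIXED window depth w, the relative weight of histories with a large-field ∕ boundary degree of
freedom deeper than w is eventually (in K, uniformly over the finer run K′) ≤ η w, with η w → 0») and §12 (a) (PRICING-NE7
v8 §45 (iii) answered K-ONLY: «intermediate runs are never inspected … NO `Summable W` anywhere»), companion of
`Support/NE7PairwiseOffsetEndWindow` (p259223).  HONEST FRAMING (page 1): FIXED FINITE T⁴, rung (B)+1 = existence AND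
uniqueness of the `ε = L^{−K} → 0` limit of unit-scale averaged expectations, CONDITIONAL on BetaPertH and the nine spine
estimates (0/9 proved); NOT infinite volume, NOT a mass gap, NOT the Clay problem.  NE7 is NOT PRINTED in
[Balaban1984PropagatorsI]–[Balaban1989LargeFieldII] and NOT proved here.  Everything below is [folklore] bookkeeping over
HYPOTHESIS SHAPES (finite families of nonnegative reals); no definition, no cite tag, nothing printed asserted, no `sorry`.

WHY.  In the K-only socket the bad class `Bad w K t ⊆ T K` of run `K` at window depth `w` is, by design, the set of
labels carrying a large-field ∕ boundary degree of freedom at SOME LEVEL `j` with `w ≤ j ≤ K` — a UNION OVER LEVELS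
`⋃_{j ∈ [w, K]} LF j` of per-level bad sets of ONE run.  If the per-level relative weights are bounded by a sequence
`p j ≥ 0` that is SUMMABLE IN THE LEVEL INDEX (printed TYPE: the per-level large-field suppression `exp(−c∕g_j²)`
decays geometrically in the level along an asymptotically free trajectory `1∕g_j² ≥ 1∕g² + b·j` — rows NE7b ∕ NE7c's
one-run sizes; a HYPOTHESIS SHAPE here), then the union's weight is `≤ (Σ_{j ∈ [w,K]} p j)·total ≤ (Σ_{j ≥ w} p j)·total`:
the bound `η w := Σ_{j ≥ w} p j` is a TAIL IN THE LEVEL INDEX, the same for every `K` (and for every finer run reading the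
same levels with the same per-level sizes), and `η w → 0` as the window deepens.  This is exactly the pair
(`hWη : ∀ w, ∀ᶠ K, W w K ≤ η w`, `hη : η → 0`) that `pairCauchy_of_kOnlyBadClasses` consumes — obtained with NO
summability in the RUN index `K` (contrast: `NE7PairwiseOffsetEndWindow.sum_biUnion_le_sum_mul`, the union over RUNS,
whose tail is in `K` and would need `Summable W`).  The two unions are the same finite-set inequality; what differs is
the index the tail lives in — LEVELS of one run (a one-run size, printed type) versus RUNS (a two-run currency).

WHAT IS PROVED ([folklore]).
§1 `sum_biUnion_le_sum_mul_of_le` (any finite index set `s`: weight of `⋃_{m∈s} B m` ≤ `(Σ_{m∈s} p m)·total`);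
   `sum_Icc_le_tsum_of_nonneg` (`Σ_{j ∈ [w,K]} p j ≤ Σ'_{j} p (j + w)` for summable `p ≥ 0`); `tendsto_tsum_tail`
   (`Σ'_j p (j + w) → 0` as `w → ∞`).
§2 **`levelUnion_weight_le_tail`** — the K-only bad-class weight bound: for every `w ≤ K`,
   `Σ_{τ ∈ ⋃_{j∈[w,K]} LF j} a τ ≤ (Σ'_j p (j + w))·total`, UNIFORM IN `K`; **`levelUnion_relWeight_eventually_le`** — the
   `hWη`-shape `∀ w, ∀ᶠ K in atTop, W w K ≤ η w` with `η w := Σ'_j p (j + w)` for ANY weight functional `W` dominated by the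
   level union's relative weight, together with `η → 0` (`tendsto_tsum_tail`).
§3 GEOMETRIC INSTANCE (the asymptotic-freedom shape): `tsum_tail_le_of_geometric` (`0 ≤ p j ≤ C·ρ^j`, `0 ≤ ρ < 1` ⟹
   `Σ'_j p (j + w) ≤ C·ρ^w∕(1 − ρ)`), `tendsto_geometric_tail` (`C·ρ^w∕(1 − ρ) → 0`).

NOT DELIVERED: the per-level suppression itself (rows NE7b ∕ NE7c: that the relative weight of a large field at level `j`
is `≤ p j` with `p` of the printed geometric type, in BOTH runs of a pair at the levels they share — the UV-uniformity of
one-run sizes modulo `NE7PairwiseCouplingUniform.couplingGap_uniform`), the identification of road P1's windowed bad class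
with a level union (road P1's END, (E♭-inst) kind (i)).  NOT NE7 (spine 0/9 unchanged), NOT summit progress.  HONEST
DEPENDENCY: continuum YM on T⁴ ⇐ BetaPertH ∧ nine spine estimates (0/9 proved); BetaPertH ⇐ (D1) ∧ (D4) ∧ CAP+tail;
G-an2-4 gates asym, D1 and NE2/3/4.
-/

noncomputable section

open Finset Filter Topology
open scoped BigOperators

namespace Summit.QuantumFields.BalabanUV.T4Continuum.NE7PairwiseDeepBadClass

open Summit.QuantumFields.BalabanUV.T4Continuum.NE7PairwiseOffsetEndWindow (sum_biUnion_le_sum_sum_of_nonneg)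

/-! ## §1 Finite unions and level tails -/

section Tails

variable {ι κ : Type*} [DecidableEq ι]

/-- WEIGHT OF A FINITE UNION ≤ (SUM OF THE PIECES' WEIGHT BOUNDS)·total, for any finite index set `s` and nonnegative weights
(`NE7PairwiseOffsetEndWindow.sum_biUnion_le_sum_mul` is the case `s = [K, K′)`). [folklore] -/
theorem sum_biUnion_le_sum_mul_of_le (s : Finset κ) (B : κ → Finset ι) {a : ι → ℝ} (ha : ∀ i, 0 ≤ a i) {p : κ → ℝ}
    {total : ℝ} (hB : ∀ m ∈ s, ∑ i ∈ B m, a i ≤ p m * total) :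
    ∑ i ∈ s.biUnion B, a i ≤ (∑ m ∈ s, p m) * total := by
  refine (sum_biUnion_le_sum_sum_of_nonneg s B ha).trans ?_
  rw [Finset.sum_mul]
  exact Finset.sum_le_sum hB

/-- A window of a nonnegative summable sequence is below its tail: `Σ_{j ∈ [w,K]} p j ≤ Σ'_j p (j + w)`. [folklore] -/
theorem sum_Icc_le_tsum_of_nonneg {p : ℕ → ℝ} (hp0 : ∀ j, 0 ≤ p j) (hp : Summable p) (w K : ℕ) :
    ∑ j ∈ Finset.Icc w K, p j ≤ ∑' j, p (j + w) := by
  have hs : Summable fun j => p (j + w) := (summable_nat_add_iff w).2 hp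
  -- reindex the window as `j = i + w`, `i ∈ range (K + 1 - w)`
  have hre : ∑ j ∈ Finset.Icc w K, p j = ∑ i ∈ Finset.range (K + 1 - w), p (i + w) := by
    rw [← Finset.Ico_add_one_right_eq_Icc, Finset.sum_Ico_eq_sum_range]
    exact Finset.sum_congr rfl fun i _ => by rw [add_comm]
  rw [hre]
  exact hs.sum_le_tsum _ (fun i _ => hp0 _)

/-- The tails of a summable sequence tend to zero: `Σ'_j p (j + w) → 0` as `w → ∞`. [folklore] -/
theorem tendsto_tsum_tail {p : ℕ → ℝ} : Tendsto (fun w => ∑' j, p (j + w)) atTop (𝓝 0) :=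
  tendsto_sum_nat_add p

end Tails

/-! ## §2 The K-only bad class as a LEVEL union: weight bound uniform in the run index -/

section LevelUnion

variable {ι : Type*} [DecidableEq ι]

/-- **THE K-ONLY BAD-CLASS WEIGHT IS A LEVEL TAIL, UNIFORMLY IN `K`.**  Per-level bad sets `LF j` of ONE run with weights
`Σ_{LF j} a ≤ p j · total` (`a ≥ 0`, `p ≥ 0` summable IN THE LEVEL INDEX): for every window depth `w` and every `K`,
`Σ_{τ ∈ ⋃_{j ∈ [w,K]} LF j} a τ ≤ (Σ'_j p (j + w))·total` — the right-hand side does not depend on `K`. [folklore] -/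
theorem levelUnion_weight_le_tail (LF : ℕ → Finset ι) {a : ι → ℝ} (ha : ∀ i, 0 ≤ a i) {p : ℕ → ℝ} (hp0 : ∀ j, 0 ≤ p j)
    (hp : Summable p) {total : ℝ} (htot : 0 ≤ total) (hLF : ∀ j, ∑ i ∈ LF j, a i ≤ p j * total) (w K : ℕ) :
    ∑ i ∈ (Finset.Icc w K).biUnion LF, a i ≤ (∑' j, p (j + w)) * total :=
  (sum_biUnion_le_sum_mul_of_le (Finset.Icc w K) LF ha (fun j _ => hLF j)).trans
    (mul_le_mul_of_nonneg_right (sum_Icc_le_tsum_of_nonneg hp0 hp w K) htot)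

/-- **THE `hWη` ∕ `hη` BINDERS OF `pairCauchy_of_kOnlyBadClasses`, FROM A LEVEL TAIL.**  If a weight functional `W w K` is
dominated, for every `w` and `K`, by the level tail `Σ'_j p (j + w)` of a nonnegative sequence summable in the LEVEL index
(e.g. by `levelUnion_weight_le_tail` after dividing by the total mass), then with `η w := Σ'_j p (j + w)`:
`∀ w, ∀ᶠ K in atTop, W w K ≤ η w` (in fact for ALL `K`) and `η → 0` — no summability in the RUN index `K` anywhere.
[folklore] -/
theorem levelUnion_relWeight_eventually_le {W : ℕ → ℕ → ℝ} {p : ℕ → ℝ}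
    (hW : ∀ w K, W w K ≤ ∑' j, p (j + w)) :
    (∀ w, ∀ᶠ K in atTop, W w K ≤ ∑' j, p (j + w)) ∧ Tendsto (fun w => ∑' j, p (j + w)) atTop (𝓝 0) :=
  ⟨fun w => Eventually.of_forall fun K => hW w K, tendsto_tsum_tail⟩

end LevelUnion

/-! ## §3 The geometric (asymptotic-freedom) shape of the per-level suppression -/

section Geometric

/-- GEOMETRIC LEVEL TAIL: `0 ≤ p j ≤ C·ρ^j` with `0 ≤ ρ < 1` ⟹ `Σ'_j p (j + w) ≤ C·ρ^w∕(1 − ρ)`. [folklore] -/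
theorem tsum_tail_le_of_geometric {p : ℕ → ℝ} {C ρ : ℝ} (hρ0 : 0 ≤ ρ) (hρ1 : ρ < 1)
    (hp0 : ∀ j, 0 ≤ p j) (hp : ∀ j, p j ≤ C * ρ ^ j) (w : ℕ) :
    ∑' j, p (j + w) ≤ C * ρ ^ w / (1 - ρ) := by
  have hgeo : Summable fun j : ℕ => C * ρ ^ w * ρ ^ j := (summable_geometric_of_lt_one hρ0 hρ1).mul_left _
  have hle : ∀ j, p (j + w) ≤ C * ρ ^ w * ρ ^ j := fun j => by
    have := hp (j + w); rw [pow_add] at this; linarith [this, mul_comm (ρ ^ j) (ρ ^ w)]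
  have hsum : Summable fun j => p (j + w) := hgeo.of_nonneg_of_le (fun j => hp0 _) hle
  calc ∑' j, p (j + w) ≤ ∑' j : ℕ, C * ρ ^ w * ρ ^ j := hsum.tsum_le_tsum hle hgeo
    _ = C * ρ ^ w * ∑' j : ℕ, ρ ^ j := tsum_mul_left
    _ = C * ρ ^ w / (1 - ρ) := by rw [tsum_geometric_of_lt_one hρ0 hρ1, div_eq_mul_inv]

/-- … and `C·ρ^w∕(1 − ρ) → 0` as the window deepens. [folklore] -/
theorem tendsto_geometric_tail {C ρ : ℝ} (hρ0 : 0 ≤ ρ) (hρ1 : ρ < 1) :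
    Tendsto (fun w : ℕ => C * ρ ^ w / (1 - ρ)) atTop (𝓝 0) := by
  have h := (tendsto_pow_atTop_nhds_zero_of_lt_one hρ0 hρ1).const_mul C
  have h' := h.div_const (1 - ρ)
  simpa using h'

/-- **THE DEEP-BAD-CLASS BINDERS FROM A GEOMETRIC PER-LEVEL SUPPRESSION** (NODE W♭'s shape): per-level bad sets of one run
with weights `≤ C·ρ^j·total` (`0 ≤ ρ < 1`) give, for the level union at window `w`, `Σ_{⋃_{j∈[w,K]} LF j} a ≤ (C·ρ^w∕(1−ρ))·total`
for EVERY `K`, and `C·ρ^w∕(1−ρ) → 0`. [folklore] -/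
theorem levelUnion_weight_le_geometric {ι : Type*} [DecidableEq ι] (LF : ℕ → Finset ι) {a : ι → ℝ} (ha : ∀ i, 0 ≤ a i)
    {C ρ total : ℝ} (hC : 0 ≤ C) (hρ0 : 0 ≤ ρ) (hρ1 : ρ < 1) (htot : 0 ≤ total)
    (hLF : ∀ j, ∑ i ∈ LF j, a i ≤ C * ρ ^ j * total) (w K : ℕ) :
    ∑ i ∈ (Finset.Icc w K).biUnion LF, a i ≤ (C * ρ ^ w / (1 - ρ)) * total := by
  have hp0 : ∀ j, 0 ≤ C * ρ ^ j := fun j => mul_nonneg hC (pow_nonneg hρ0 _)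
  have hp : Summable fun j => C * ρ ^ j := (summable_geometric_of_lt_one hρ0 hρ1).mul_left C
  refine (levelUnion_weight_le_tail LF ha hp0 hp htot hLF w K).trans ?_
  exact mul_le_mul_of_nonneg_right (tsum_tail_le_of_geometric hρ0 hρ1 hp0 (fun j => le_rfl) w) htot

end Geometric

end Summit.QuantumFields.BalabanUV.T4Continuum.NE7PairwiseDeepBadClass

end
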